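import Mathlib
import Summits.CriticalPhenomena.CardyFormulaZ2.Theorems.CardyWhiteToColouredDriftBoundPlackettDefs
import Summits.CriticalPhenomena.CardyFormulaZ2.Theorems.CardyWhiteToColouredDriftBoundPlackettNormWeight
import Summits.CriticalPhenomena.CardyFormulaZ2.Theorems.CardyWhiteToColouredDriftBoundPlackettRegIndicator
import Summits.CriticalPhenomena.CardyFormulaZ2.Theorems.CardyWhiteToColouredDriftBoundPlackettIBP
import Summits.CriticalPhenomena.CardyFormulaZ2.Theorems.CardyWhiteToColouredDriftBoundPlackettEnvelope
import Summits.CriticalPhenomena.CardyFormulaZ2.Theorems.CardyWhiteToColouredDriftBoundPlackettDeriv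

/-!
# Plackett/Piterbarg drift of the noise heat flow: continuity of the pair functional in the width

Helper file for crux item `DriftBound` (stmt-CriticalPhenomena-4596, decl
`Summit.CriticalPhenomena.CardyFormulaZ2.Theses.CardyWhiteToColoured.DriftBound`) of route
`CardyWhiteToColoured` (`CardyFormulaZ2`), line `registered` (`Cruxes/DriftBound/Lines/birth.lean`,
skeleton v4, lead c3), stub S2 `stub_driftContinuous` = continuity of the Plackett/Piterbarg pair
functional in the width: for `η > 0` the map

  `σ ↦ plackettDrift I A η σ = ∑_{i,j ∈ I} plackettCoeff σ (m i) (m j) · E_ξ[∂_j ∂_i Φ_η(X̃^σ ξ)]`,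

`Φ_η = regIndicator I A η`, `X̃^σ_i ξ = normNoise σ ξ (m i) = ∑' e, normWeight σ (m i) e ξ_e`, is
continuous on `(0, ∞)`. The skeleton integrates the exact drift identity
`d/dσ regFlow I A η σ = plackettDrift I A η σ` over `[σ₁, σ₂] ⊂ (0, ∞)` (fundamental theorem of
calculus) and needs this continuity for the interval integrability of the derivative.

Proof. A finite double sum of products, so it suffices to treat, locally around each `σ₀ > 0`
(on the neighbourhood `(σ₀/2, 2σ₀)`), the two factors:
* `σ ↦ plackettCoeff σ x y = ∑' e, ∂_σ(normWeight σ x e) · normWeight σ y e`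
  (`dc_continuousOn_plackettCoeff`): each term is continuous on `(0, ∞)` and on `[σ₀/2, 2σ₀]` the
  terms are dominated by `u_x e · ∑' u_y`, `u_x`, `u_y` the summable envelopes of
  `pl_normWeight_family`; conclude by `continuousOn_tsum` (locally uniform convergence);
* `σ ↦ E_ξ[H(X̃^σ ξ)]` for a bounded continuous `H : ℝ^I → ℝ` (`dc_continuousOn_integral`):
  dominated convergence (`continuousAt_of_dominated`, constant bound on a probability space); for
  almost every noise `ξ` the envelope series `∑_e u_e |ξ_e|` converges (`pl_ae_summable_envelope`),
  and then each coordinate `σ ↦ ∑' e, normWeight σ (m i) e ξ_e` is continuous on `(σ₀/2, 2σ₀)`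
  (`continuousOn_tsum` again), hence so is `σ ↦ H(X̃^σ ξ)`;
  here `H = ∂_j ∂_i Φ_η` is continuous and bounded since `Φ_η ∈ C²_b` (`pl_regIndicator_smooth`,
  `pb_norm_fderiv_partial_le`).

References: D. Beliaev, S. Muirhead, A. Rivera, *A covariance formula for topological events of
smooth Gaussian fields*, Ann. Probab. 48 (2020), §2.2, Lemma 2.22 (Piterbarg's formula);
R. L. Plackett, Biometrika 41 (1954).
-/

noncomputable section

namespace Summit.CriticalPhenomena.CardyFormulaZ2.Cruxes.DriftBound.Birth

open MeasureTheory ProbabilityTheory Filter Topology Set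
open Literature.Probability.LatticeModels Literature.Probability.Percolation

/-! ### The Plackett coefficient is continuous in the width -/

/-- **Continuity of the Plackett coefficient.** For any two points `x, y`, the pairing
`σ ↦ plackettCoeff σ x y = ∑' e, ∂_σ(normWeight σ x e) · normWeight σ y e` is continuous on
`(0, ∞)`: around `σ₀ > 0`, on `(σ₀/2, 2σ₀)`, it is a series of continuous functions dominated by the
summable `e ↦ u_x e · ∑' e', u_y e'` (`pl_normWeight_family` at `x` and at `y` on `[σ₀/2, 2σ₀]`). -/
theorem dc_continuousOn_plackettCoeff (x y : ℂ) :
    ContinuousOn (fun σ : ℝ => plackettCoeff σ x y) (Ioi 0) := by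
  intro σ₀ hσ₀
  replace hσ₀ : 0 < σ₀ := hσ₀
  have ha : 0 < σ₀ / 2 := by positivity
  have hab : σ₀ / 2 ≤ 2 * σ₀ := by linarith
  have hmem : Ioo (σ₀ / 2) (2 * σ₀) ∈ 𝓝 σ₀ := Ioo_mem_nhds (by linarith) (by linarith)
  have hsub : Ioo (σ₀ / 2) (2 * σ₀) ⊆ Ioi 0 := fun σ hσ => ha.trans hσ.1
  obtain ⟨-, -, hdc, u, hu, hub⟩ := pl_normWeight_family x (σ₀ / 2) (2 * σ₀) ha hab
  obtain ⟨-, hdiff, -, w, hw, hwb⟩ := pl_normWeight_family y (σ₀ / 2) (2 * σ₀) ha hab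
  have hw0 : ∀ e, 0 ≤ w e := fun e => (abs_nonneg _).trans (hwb _ (left_mem_Icc.2 hab) e).1
  refine (ContinuousOn.continuousAt ?_ hmem).continuousWithinAt
  unfold plackettCoeff
  refine continuousOn_tsum (u := fun e => u e * ∑' e', w e') (fun e => ?_) (hu.mul_right _)
    fun e σ hσ => ?_
  · exact ((hdc e).mono hsub).mul fun σ hσ =>
      (hdiff e σ (hsub hσ)).continuousAt.continuousWithinAt
  · obtain ⟨-, h1⟩ := hub σ (Ioo_subset_Icc_self hσ) e
    obtain ⟨h2, -⟩ := hwb σ (Ioo_subset_Icc_self hσ) e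
    rw [Real.norm_eq_abs, abs_mul]
    exact mul_le_mul h1 (h2.trans (hw.le_tsum e fun e' _ => hw0 e')) (abs_nonneg _)
      ((abs_nonneg _).trans h1)

/-! ### Bounded continuous functionals of the normalised field are continuous in the width -/

/-- **Dominated convergence in the width.** For a finite edge set `I` and a bounded continuous
`H : ℝ^I → ℝ`, the expectation `σ ↦ E_ξ[H(X̃^σ ξ)]`, `X̃^σ_i ξ = normNoise σ ξ (m i)`, is
continuous on `(0, ∞)`: the integrand is bounded by a constant (integrable, `latticeWhiteNoise` is a
probability measure), measurable (`pd_measurable_linSeries` after `normNoise_eq_tsum`), and for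
almost every `ξ` continuous in `σ` near `σ₀ > 0` — off the null set where one of the finitely many
envelope series `∑_e u_e |ξ_e|` (`pl_normWeight_family (m i) (σ₀/2) (2σ₀)`,
`pl_ae_summable_envelope`) diverges, each coordinate `σ ↦ ∑' e, normWeight σ (m i) e ξ_e` is
continuous on `(σ₀/2, 2σ₀)` by `continuousOn_tsum`. -/
theorem dc_continuousOn_integral {I : Finset (Sym2 (Site 2))} {H : (I → ℝ) → ℝ}
    (hH : Continuous H) {M : ℝ} (hM : ∀ y, ‖H y‖ ≤ M) :
    ContinuousOn (fun σ : ℝ =>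
      ∫ ξ, H (fun i' : I => normNoise σ ξ (medialPoint 1 i'.1)) ∂latticeWhiteNoise) (Ioi 0) := by
  intro σ₀ hσ₀
  replace hσ₀ : 0 < σ₀ := hσ₀
  have ha : 0 < σ₀ / 2 := by positivity
  have hab : σ₀ / 2 ≤ 2 * σ₀ := by linarith
  have hmem : Ioo (σ₀ / 2) (2 * σ₀) ∈ 𝓝 σ₀ := Ioo_mem_nhds (by linarith) (by linarith)
  have hsub : Ioo (σ₀ / 2) (2 * σ₀) ⊆ Ioi 0 := fun σ hσ => ha.trans hσ.1
  simp_rw [normNoise_eq_tsum]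
  refine (continuousAt_of_dominated (μ := latticeWhiteNoise) (bound := fun _ => M)
    (F := fun (σ : ℝ) (ξ : (zdGraph 2).edgeSet → ℝ) =>
      H (fun i' : I => ∑' e : (zdGraph 2).edgeSet, normWeight σ (medialPoint 1 i'.1) e * ξ e))
    (Eventually.of_forall fun σ => ?_) (Eventually.of_forall fun σ => ae_of_all _ fun ξ => hM _)
    (integrable_const M) ?_).continuousWithinAt
  · exact (hH.measurable.comp (pd_measurable_linSeries
      fun (i' : I) (e : (zdGraph 2).edgeSet) =>
        normWeight σ (medialPoint 1 i'.1) e)).aestronglyMeasurable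
  · -- almost surely, every coordinate of the field is continuous in `σ` on `(σ₀/2, 2σ₀)`
    have hcoord : ∀ i' : I, ∀ᵐ ξ ∂latticeWhiteNoise, ContinuousOn (fun σ : ℝ =>
        ∑' e : (zdGraph 2).edgeSet, normWeight σ (medialPoint 1 i'.1) e * ξ e)
        (Ioo (σ₀ / 2) (2 * σ₀)) := by
      intro i'
      obtain ⟨-, hdiff, -, u, hu, hub⟩ :=
        pl_normWeight_family (medialPoint 1 i'.1) (σ₀ / 2) (2 * σ₀) ha hab
      have hu0 : ∀ e, 0 ≤ u e := fun e => (abs_nonneg _).trans (hub _ (left_mem_Icc.2 hab) e).1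
      have hae : ∀ᵐ ξ ∂latticeWhiteNoise, Summable fun e => u e * |ξ e| :=
        pl_ae_summable_envelope hu hu0
      filter_upwards [hae] with ξ hξ
      refine continuousOn_tsum (fun e σ hσ => ?_) hξ fun e σ hσ => ?_
      · exact ((hdiff e σ (hsub hσ)).continuousAt.mul continuousAt_const).continuousWithinAt
      · rw [Real.norm_eq_abs, abs_mul]
        exact mul_le_mul_of_nonneg_right (hub σ (Ioo_subset_Icc_self hσ) e).1 (abs_nonneg _)
    filter_upwards [ae_all_iff.2 hcoord] with ξ hξ
    exact (hH.comp_continuousOn (continuousOn_pi.2 hξ)).continuousAt hmem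

/-! ### The mixed second partial derivatives of a `C²_b` function -/

section Partial

variable {κ : Type*} [Fintype κ] [DecidableEq κ]

/-- The mixed second partial derivative `y ↦ D(∂_i Ψ)(y)[w]`, `∂_i Ψ(y) = DΨ(y)[e_i]`, of
`Ψ ∈ C²` is continuous (`∂_i Ψ` is `C¹`). -/
theorem dc_continuous_fderiv_partial {Ψ : (κ → ℝ) → ℝ} (hΨ : ContDiff ℝ 2 Ψ) (i : κ) (w : κ → ℝ) :
    Continuous fun y => fderiv ℝ (fun y => fderiv ℝ Ψ y (Pi.single i 1)) y w := by
  have h1 : ContDiff ℝ 1 (fun y => fderiv ℝ Ψ y (Pi.single i 1)) :=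
    (hΨ.fderiv_right (m := 1) (by norm_num)).clm_apply contDiff_const
  exact (h1.continuous_fderiv one_ne_zero).clm_apply continuous_const

/-- The mixed second partial derivative `D(∂_i Ψ)(y)[e_j]` is bounded by any bound `M` on
`‖D²Ψ‖` (`pb_norm_fderiv_partial_le` and `‖e_j‖ = 1`). -/
theorem dc_norm_fderiv_partial_apply_le {Ψ : (κ → ℝ) → ℝ} (hΨ : ContDiff ℝ 2 Ψ) {M : ℝ}
    (hM : ∀ x, ‖fderiv ℝ (fderiv ℝ Ψ) x‖ ≤ M) (i j : κ) (y : κ → ℝ) :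
    ‖fderiv ℝ (fun y => fderiv ℝ Ψ y (Pi.single i 1)) y (Pi.single j 1)‖ ≤ M := by
  calc ‖fderiv ℝ (fun y => fderiv ℝ Ψ y (Pi.single i 1)) y (Pi.single j 1)‖
      ≤ M * ‖(Pi.single j (1 : ℝ) : κ → ℝ)‖ :=
        (fderiv ℝ (fun y => fderiv ℝ Ψ y (Pi.single i 1)) y).le_of_opNorm_le
          (pb_norm_fderiv_partial_le hΨ hM i y) _
    _ = M := by rw [Pi.norm_single, norm_one, mul_one]

end Partial

/-! ### The registered stub -/

/-- **Stub S2 — continuity of the Plackett/Piterbarg pair functional in the width.** For every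
finite edge set `I`, event `A` and noise level `η > 0`, `σ ↦ plackettDrift I A η σ` is continuous on
`(0, ∞)`: a finite double sum (`continuousOn_finsetSum`) of products of the Plackett coefficients
`σ ↦ plackettCoeff σ (m i) (m j)` (`dc_continuousOn_plackettCoeff`) and the expectations
`σ ↦ E_ξ[∂_j ∂_i Φ_η(X̃^σ ξ)]` (`dc_continuousOn_integral`, the mixed second partial derivative of
`Φ_η = regIndicator I A η ∈ C²_b` — `pl_regIndicator_smooth` — being continuous and bounded,
`dc_continuous_fderiv_partial`, `dc_norm_fderiv_partial_apply_le`). -/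
theorem stub_driftContinuous : ∀ (I : Finset (Sym2 (Literature.Probability.LatticeModels.Site 2))) (A : Set (Set (Sym2 (Literature.Probability.LatticeModels.Site 2)))) (η : ℝ), 0 < η → ContinuousOn (fun s : ℝ => plackettDrift I A η s) (Set.Ioi 0) := by
  intro I A η hη
  obtain ⟨hΦ, M, -, -, hM2⟩ := pl_regIndicator_smooth I A η hη
  unfold plackettDrift
  refine continuousOn_finsetSum _ fun i _ => continuousOn_finsetSum _ fun j _ => ?_
  exact (dc_continuousOn_plackettCoeff _ _).mul
    (dc_continuousOn_integral (dc_continuous_fderiv_partial hΦ i (Pi.single j 1))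
      (dc_norm_fderiv_partial_apply_le hΦ hM2 i j))

end Summit.CriticalPhenomena.CardyFormulaZ2.Cruxes.DriftBound.Birth

end
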